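import Summits.RiemannHypothesis.RiemannHypothesis.Theorems.WeilCombCombShapePositivityMertensAll
import Literature.NumberTheory.LFunctions.RosserSchoenfeldEq321Tabulated
import HarnessLib

/-!
# The Mertens remainder from below on `[20, 10⁴)` and the prime-power sum at `10⁴`, by kernel computation
# (STUB-PLAN `stub_windowCore`, Phase A, lower side — kernel part)

Crux `WeilComb.CombShapePositivity` (item stmt-RiemannHypothesis-11229), line `Sketch`. Kernel half of the LOWER
Mertens bound (assembled in `…MertensLower.lean`): a `2⁸⁰` fixed-point run `lowerRun` over `2 ≤ n ≤ 10⁴`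
(`decide +kernel`, standard axioms, ≈ 40 s of kernel time), kernel-friendly throughout — primes recognised by the
tree's `ThetaChain.primeChk`, the 51 higher prime powers `pʲ ≤ 10⁴` from the literal table `ppList`, the logarithm
carried along by the cheap increments `KernelLog.log1pIv 1 n` (`log(n+1) = log n + log(1 + 1/n)`), full logarithms
`KernelLog.logIv` only for the 51 table entries. Invariants `Llo ≤ 2⁸⁰ log n ≤ Lhi`, `P ≤ 2⁸⁰ ψ₁(n)`,
`Q ≤ 2⁸⁰ Σ_{k ≤ n, k ∉ ℙ} Λ(k)/k`; for every `20 ≤ n ≤ 9999` the test `Lhi(n+1) ≤ P(n) + GAMMALO + C9N` bounds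
`E₁ = ψ₁ − log + γ` on `[n, n+1)` from below by `−9/100`, and at the end `Q ≥ PPTHRESH`. Soundness:
`consume_sound`, `test_sound`, `lowerRun_sound`, `lower_facts`; tree-vocabulary consequences
`stub_mertensLowerSmall` (registered: `−9/100 ≤ ψ₁(N) − log(N+1) + γ`, `20 ≤ N ≤ 9999`) and
`primePowerSum_ge` (`0.7437 ≤ Σ_{1 < k ≤ 10⁴, k ∉ ℙ} Λ(k)/k`).
-/

-- the sub-problem path RiemannHypothesis/RiemannHypothesis duplicates a namespace (D-0017)
set_option linter.dupNamespace false

open Finset ArithmeticFunction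

namespace Summit.RiemannHypothesis.RiemannHypothesis.Theorems.WeilCombMertensLowerKernel

open Literature.NumberTheory.LFunctions Literature.Analysis.SpecialFunctions.KernelLog
open ChainCheck (GAMMALO GAMMALO_le)
open ThetaChain (primeChk primeChk_sound)
open WeilCombMertensSmall (C9 C9_le psiOneNat psiOneNat_succ)

/-! ### The kernel checker (no `Nat.minFac`, no well-founded recursion in the hot loop) -/

/-- Kernel-friendly primality for `n < 4635409`: `n = 2`, or `n` odd and accepted by `ThetaChain.primeChk`. [folklore] -/
def isPrimeK (n : ℕ) : Bool :=
  Nat.beq n 2 || (Nat.beq (n % 2) 1 && primeChk n)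

/-- The prime powers `q = pʲ ≤ 10⁴` with `j ≥ 2`, as `(q, p, j)`, increasing in `q`. [folklore] -/
def ppList : List (ℕ × ℕ × ℕ) :=
  [(4, 2, 2), (8, 2, 3), (9, 3, 2), (16, 2, 4), (25, 5, 2), (27, 3, 3), (32, 2, 5), (49, 7, 2), (64, 2, 6), (81, 3, 4),
   (121, 11, 2), (125, 5, 3), (128, 2, 7), (169, 13, 2), (243, 3, 5), (256, 2, 8), (289, 17, 2), (343, 7, 3),
   (361, 19, 2), (512, 2, 9), (529, 23, 2), (625, 5, 4), (729, 3, 6), (841, 29, 2), (961, 31, 2), (1024, 2, 10),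
   (1331, 11, 3), (1369, 37, 2), (1681, 41, 2), (1849, 43, 2), (2048, 2, 11), (2187, 3, 7), (2197, 13, 3),
   (2209, 47, 2), (2401, 7, 4), (2809, 53, 2), (3125, 5, 5), (3481, 59, 2), (3721, 61, 2), (4096, 2, 12),
   (4489, 67, 2), (4913, 17, 3), (5041, 71, 2), (5329, 73, 2), (6241, 79, 2), (6561, 3, 8), (6859, 19, 3),
   (6889, 83, 2), (7921, 89, 2), (8192, 2, 13), (9409, 97, 2)]

/-- Validity of a table entry: `pʲ = q`, `2 ≤ j`, `p` prime (kernel check). [folklore] -/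
def entryOK (e : ℕ × ℕ × ℕ) : Bool :=
  Nat.beq (e.2.1 ^ e.2.2) e.1 && Nat.ble 2 e.2.2 && isPrimeK e.2.1

/-- `⌊lo(log p)/n⌋` (units `2⁻⁸⁰`): a lower bound for `2⁸⁰ (log p)/n` from a full logarithm (used only for the 51
higher prime powers); `0` without enclosure. [folklore] -/
def incLog (p n : ℕ) : ℕ :=
  match logIv p with
  | some (lg, _) => lg.toNat / n
  | none => 0

/-- Consume the table at `m`, given a lower bound `Llo ≤ 2⁸⁰ log m`: the increments `(dP, dQ)` for `ψ₁` and for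
the non-prime part, and the rest of the table. [folklore] -/
def consume (m Llo : ℕ) : List (ℕ × ℕ × ℕ) → ℕ × ℕ × List (ℕ × ℕ × ℕ)
  | [] => (if isPrimeK m then Llo / m else 0, 0, [])
  | (q, p, j) :: rest =>
    if q = m then (incLog p m, incLog p m, rest)
    else (if isPrimeK m then Llo / m else 0, 0, (q, p, j) :: rest)

/-- `⌊(9/100) · 2⁸⁰⌋` as a natural number. [folklore] -/
def C9N : ℕ := 108803323765316625723555

/-- `⌊(PP(10⁴) − 10⁻⁹)·2⁸⁰⌋`, `PP(10⁴) = Σ_{pʲ ≤ 10⁴, j ≥ 2} (log p)/pʲ = 0.7437757…`. [folklore] -/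
def PPTHRESH : ℕ := 899169650921460455178240

/-- **The run.** State `(n, Llo, Lhi, P, Q, rest)` with `Llo ≤ 2⁸⁰ log n ≤ Lhi`, `P ≤ 2⁸⁰ψ₁(n)`,
`Q ≤ 2⁸⁰ Σ_{k ≤ n, k ∉ ℙ} Λ(k)/k`. One step: the logarithm moves by the cheap increment `log1pIv 1 n`
(`log(n+1) = log n + log(1 + 1/n)`); the test for the interval `[n, n+1)` (when `n ≥ 20`) is
`Lhi(n+1) ≤ P(n) + GAMMALO + C9N`; then the increments at `n+1` are added. At the end the accumulated non-prime part
must reach `PPTHRESH`. [folklore] -/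
def lowerRun : ℕ → ℕ → ℕ → ℕ → ℕ → ℕ → List (ℕ × ℕ × ℕ) → Bool
  | 0, _, _, _, _, Q, _ => Nat.ble PPTHRESH Q
  | fuel + 1, n, Llo, Lhi, P, Q, rest =>
    match log1pIv 1 n with
    | none => false
    | some (dlo, dhi) =>
      (!(Nat.ble 20 n) || Nat.ble (Lhi + dhi.toNat) (P + GAMMALO + C9N)) &&
        (match consume (n + 1) (Llo + dlo.toNat) rest with
          | (dP, dQ, rest') =>
            lowerRun fuel (n + 1) (Llo + dlo.toNat) (Lhi + dhi.toNat) (P + dP) (Q + dQ) rest')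

/-- The table entries are valid. [folklore] -/
theorem ppList_ok : ppList.all entryOK = true := by
  decide +kernel

set_option maxHeartbeats 0 in
/-- **The certified lower run from `n = 2` to `n = 10⁴`** (initial state: `log 2 ∈ [L2LON, L2HIN]/2⁸⁰`,
`P = ⌊L2LON/2⌋ ≤ 2⁸⁰ (log 2)/2 = 2⁸⁰ψ₁(2)`, `Q = 0`; tests for `[n, n+1)`, `20 ≤ n ≤ 9999`; then `PPTHRESH ≤ Q`).
[folklore] -/
theorem lowerRun_holds : lowerRun 9998 2 ChainCheck.L2LON ChainCheck.L2HIN (ChainCheck.L2LON / 2) 0 ppList = true := by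
  decide +kernel

/-! ### Soundness -/

/-- `isPrimeK` is sound below `4635409`. [folklore] -/
theorem isPrimeK_sound {n : ℕ} (h : isPrimeK n = true) (hn : n < 4635409) : n.Prime := by
  unfold isPrimeK at h
  simp only [Bool.or_eq_true, Bool.and_eq_true] at h
  rcases h with h2 | ⟨hodd, hchk⟩
  · rw [Nat.beq_eq] at h2
    rw [h2]
    exact Nat.prime_two
  · rw [Nat.beq_eq] at hodd
    exact primeChk_sound hchk (Nat.odd_iff.2 hodd) hn

/-- **Soundness of `incLog`**: if `Λ n = log p` (with `p ≥ 1`) then `incLog p n ≤ 2⁸⁰ Λ(n)/n`. [folklore] -/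
theorem incLog_sound {p n : ℕ} (hp : 1 ≤ p) (hΛ : (Λ n : ℝ) = Real.log p) :
    (incLog p n : ℝ) ≤ 2 ^ 80 * ((Λ n : ℝ) / n) := by
  have hlog0 : 0 ≤ Real.log p := Real.log_nonneg (by exact_mod_cast hp)
  have hΛ0 : 0 ≤ 2 ^ 80 * ((Λ n : ℝ) / n) := by positivity [vonMangoldt_nonneg (n := n)]
  unfold incLog
  cases hl : logIv p with
  | none => simpa using hΛ0
  | some lohi =>
    obtain ⟨lo, hi⟩ := lohi
    simp only
    rcases Nat.eq_zero_or_pos n with rfl | hn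
    · simp
    have hn0 : (0 : ℝ) < n := by exact_mod_cast hn
    have hs := (logIv_sound hl).1
    have hlo : ((lo.toNat : ℕ) : ℝ) ≤ 2 ^ 80 * Real.log p := by
      rcases le_or_gt 0 lo with h0 | h0
      · have e1 : ((lo.toNat : ℤ) : ℝ) = (lo : ℝ) := by exact_mod_cast Int.toNat_of_nonneg h0
        have e2 : ((lo.toNat : ℕ) : ℝ) = ((lo.toNat : ℤ) : ℝ) := by norm_cast
        rw [e2, e1]
        rw [div_le_iff₀ (by positivity)] at hs
        linarith
      · rw [Int.toNat_eq_zero.2 h0.le, Nat.cast_zero]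
        positivity
    calc ((lo.toNat / n : ℕ) : ℝ) ≤ (lo.toNat : ℝ) / n := Nat.cast_div_le
      _ ≤ 2 ^ 80 * Real.log p / n := by gcongr
      _ = 2 ^ 80 * ((Λ n : ℝ) / n) := by rw [hΛ]; ring

/-- The non-prime part of `Λ(k)/k`. [folklore] -/
noncomputable def npTerm (k : ℕ) : ℝ := (if k.Prime then 0 else (Λ k : ℝ)) / (k : ℝ)

/-- `npTerm k ≥ 0`. [folklore] -/
theorem npTerm_nonneg (k : ℕ) : 0 ≤ npTerm k := by
  unfold npTerm
  split_ifs
  · simp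
  · positivity [vonMangoldt_nonneg (n := k)]

/-- **Soundness of `consume`** at `m ≤ 10⁴` for a valid table and `Llo ≤ 2⁸⁰ log m`: `dP ≤ 2⁸⁰ Λ(m)/m`,
`dQ ≤ 2⁸⁰·npTerm m`, and the returned table is valid. [folklore] -/
theorem consume_sound {m Llo : ℕ} (hm : m ≤ 10000) (hL : (Llo : ℝ) ≤ 2 ^ 80 * Real.log m)
    {rest : List (ℕ × ℕ × ℕ)} (hvalid : ∀ e ∈ rest, entryOK e = true) :
    (((consume m Llo rest).1 : ℕ) : ℝ) ≤ 2 ^ 80 * ((Λ m : ℝ) / m) ∧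
    (((consume m Llo rest).2.1 : ℕ) : ℝ) ≤ 2 ^ 80 * npTerm m ∧
    (∀ e ∈ (consume m Llo rest).2.2, entryOK e = true) := by
  have hΛ0 : 0 ≤ 2 ^ 80 * ((Λ m : ℝ) / m) := by positivity [vonMangoldt_nonneg (n := m)]
  have hT0 : 0 ≤ 2 ^ 80 * npTerm m := by positivity [npTerm_nonneg m]
  -- the prime increment `⌊Llo/m⌋ ≤ 2⁸⁰ (log m)/m = 2⁸⁰ Λ(m)/m`
  have hprime : (((if isPrimeK m then Llo / m else 0 : ℕ) : ℕ) : ℝ) ≤ 2 ^ 80 * ((Λ m : ℝ) / m) := by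
    split_ifs with hpk
    · have hmp : m.Prime := isPrimeK_sound hpk (by omega)
      have hm0 : (0 : ℝ) < m := by exact_mod_cast hmp.pos
      rw [vonMangoldt_apply_prime hmp]
      calc ((Llo / m : ℕ) : ℝ) ≤ (Llo : ℝ) / m := Nat.cast_div_le
        _ ≤ 2 ^ 80 * Real.log m / m := by gcongr
        _ = 2 ^ 80 * (Real.log m / m) := by ring
    · simpa using hΛ0
  cases rest with
  | nil =>
    refine ⟨?_, ?_, ?_⟩
    · simpa [consume] using hprime
    · simp [consume, hT0]
    · simp [consume]
  | cons e rest' =>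
    obtain ⟨q, p, j⟩ := e
    have he := hvalid (q, p, j) (by simp)
    have hrest : ∀ e ∈ rest', entryOK e = true := fun e he' ↦ hvalid e (by simp [he'])
    by_cases hqm : q = m
    · -- a prime power `m = p^j`, `j ≥ 2`
      unfold entryOK at he
      simp only [Bool.and_eq_true] at he
      obtain ⟨⟨hpow, hj⟩, hpk⟩ := he
      rw [Nat.beq_eq] at hpow
      rw [Nat.ble_eq] at hj
      have hp : p.Prime := isPrimeK_sound hpk (by
        have : p ≤ p ^ j := Nat.le_self_pow (by omega) p
        omega)
      have hmeq : m = p ^ j := by rw [← hqm, ← hpow]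
      have hΛm : (Λ m : ℝ) = Real.log p := by
        rw [hmeq, vonMangoldt_apply_pow (by omega), vonMangoldt_apply_prime hp]
      have hnp : ¬ m.Prime := by
        intro hmp
        rw [hmeq] at hmp
        rcases hmp.eq_one_or_self_of_dvd p (dvd_pow_self p (by omega)) with h1 | h1
        · exact hp.one_lt.ne' h1
        · -- `p = p ^ j` forces `j = 1`
          have hj1 : p ^ 1 = p ^ j := by rw [pow_one]; exact h1
          have := Nat.pow_right_injective hp.two_le hj1
          omega
      have hinc := incLog_sound (n := m) hp.one_lt.le hΛm
      have hterm : 2 ^ 80 * ((Λ m : ℝ) / m) = 2 ^ 80 * npTerm m := by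
        unfold npTerm; rw [if_neg hnp]
      refine ⟨?_, ?_, ?_⟩
      · simp only [consume, if_pos hqm]; exact hinc
      · simp only [consume, if_pos hqm]; rw [← hterm]; exact hinc
      · simp only [consume, if_pos hqm]; exact hrest
    · refine ⟨?_, ?_, ?_⟩
      · simp only [consume, if_neg hqm]; exact hprime
      · simp only [consume, if_neg hqm]; simpa using hT0
      · simp only [consume, if_neg hqm]; exact hvalid

/-- **Soundness of the test**: `Lhi' ≤ P + GAMMALO + C9N` with `2⁸⁰ log(n+1) ≤ Lhi'` and `P ≤ 2⁸⁰ ψ₁(n)` gives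
`−9/100 ≤ ψ₁(n) − log(n+1) + γ`. [folklore] -/
theorem test_sound {n P Lhi' : ℕ} (h : Nat.ble Lhi' (P + GAMMALO + C9N) = true)
    (hL : 2 ^ 80 * Real.log ((n : ℝ) + 1) ≤ (Lhi' : ℝ)) (hP : (P : ℝ) ≤ 2 ^ 80 * psiOneNat n) :
    -(9 / 100 : ℝ) ≤ psiOneNat n - Real.log ((n : ℝ) + 1) + Real.eulerMascheroniConstant := by
  have h' : Lhi' ≤ P + GAMMALO + C9N := Nat.le_of_ble_eq_true h
  have hR : (Lhi' : ℝ) ≤ (P : ℝ) + GAMMALO + C9N := by exact_mod_cast h'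
  have hγ := GAMMALO_le
  have hC : (C9N : ℝ) ≤ 9 / 100 * 2 ^ 80 := by norm_num [C9N]
  have key : 2 ^ 80 * (Real.log ((n : ℝ) + 1) - 9 / 100) ≤
      2 ^ 80 * (psiOneNat n + Real.eulerMascheroniConstant) := by linarith
  have := le_of_mul_le_mul_left key (by positivity : (0 : ℝ) < 2 ^ 80)
  linarith

/-- `Σ_{k ≤ n+1} npTerm = Σ_{k ≤ n} npTerm + npTerm (n+1)`. [folklore] -/
theorem sum_npTerm_succ (n : ℕ) :
    ∑ k ∈ Finset.Ioc 1 (n + 1), npTerm k = ∑ k ∈ Finset.Ioc 1 n, npTerm k + npTerm (n + 1) := by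
  rcases Nat.eq_zero_or_pos n with rfl | hn
  · simp [npTerm, Nat.not_prime_one]
  · rw [Finset.sum_Ioc_succ_top (by omega)]

/-- **Soundness of the lower run.** If the run succeeds from a sound state with a valid table, every interval
`[k, k+1)` with `n ≤ k < n + fuel`, `k ≥ 20`, satisfies `−9/100 ≤ ψ₁(k) − log(k+1) + γ`, and the non-prime part at
`n + fuel` is at least `PPTHRESH/2⁸⁰`. [folklore] -/
theorem lowerRun_sound : ∀ (fuel n Llo Lhi P Q : ℕ) (rest : List (ℕ × ℕ × ℕ)),
    lowerRun fuel n Llo Lhi P Q rest = true → 1 ≤ n → n + fuel ≤ 10000 → (∀ e ∈ rest, entryOK e = true) →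
    (Llo : ℝ) ≤ 2 ^ 80 * Real.log n → 2 ^ 80 * Real.log n ≤ (Lhi : ℝ) →
    (P : ℝ) ≤ 2 ^ 80 * psiOneNat n → (Q : ℝ) ≤ 2 ^ 80 * ∑ k ∈ Finset.Ioc 1 n, npTerm k →
    (∀ k : ℕ, n ≤ k → k < n + fuel → 20 ≤ k →
        -(9 / 100 : ℝ) ≤ psiOneNat k - Real.log ((k : ℝ) + 1) + Real.eulerMascheroniConstant) ∧
      (PPTHRESH : ℝ) ≤ 2 ^ 80 * ∑ k ∈ Finset.Ioc 1 (n + fuel), npTerm k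
  | 0, n, Llo, Lhi, P, Q, rest, hrun, _, _, _, _, _, _, hQ => by
    refine ⟨fun k h1 h2 _ ↦ by omega, ?_⟩
    unfold lowerRun at hrun
    have : PPTHRESH ≤ Q := Nat.le_of_ble_eq_true hrun
    have : (PPTHRESH : ℝ) ≤ Q := by exact_mod_cast this
    simpa using this.trans hQ
  | fuel + 1, n, Llo, Lhi, P, Q, rest, hrun, hn1, hfuel, hvalid, hLlo, hLhi, hP, hQ => by
    unfold lowerRun at hrun
    revert hrun
    cases hl : log1pIv 1 n with
    | none => simp
    | some dd =>
      obtain ⟨dlo, dhi⟩ := dd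
      intro hrun
      simp only [Bool.and_eq_true, Bool.or_eq_true, Bool.not_eq_true'] at hrun
      obtain ⟨htest, hcont⟩ := hrun
      -- the new logarithm enclosure
      have hn0 : (0 : ℝ) < n := by exact_mod_cast (show 0 < n by omega)
      obtain ⟨h1lo, h1hi⟩ := log1pIv_sound hl
      have hlog : Real.log ((n : ℝ) + 1) = Real.log n + Real.log (1 + ((1 : ℕ) : ℝ) / n) := by
        rw [← Real.log_mul hn0.ne' (by positivity)]
        congr 1
        push_cast
        field_simp
      have hLlo' : ((Llo + dlo.toNat : ℕ) : ℝ) ≤ 2 ^ 80 * Real.log ((n : ℝ) + 1) := by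
        rw [hlog, mul_add]
        push_cast
        have hmono : (dlo.toNat : ℝ) ≤ 2 ^ 80 * Real.log (1 + ((1 : ℕ) : ℝ) / n) ∨ dlo.toNat = 0 := by
          rcases le_or_gt 0 dlo with h0 | h0
          · left
            have e1 : ((dlo.toNat : ℤ) : ℝ) = (dlo : ℝ) := by exact_mod_cast Int.toNat_of_nonneg h0
            have e2 : ((dlo.toNat : ℕ) : ℝ) = ((dlo.toNat : ℤ) : ℝ) := by norm_cast
            rw [e2, e1]
            rw [div_le_iff₀ (by positivity)] at h1lo
            linarith
          · right
            exact Int.toNat_eq_zero.2 h0.le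
        have hpos : 0 ≤ 2 ^ 80 * Real.log (1 + ((1 : ℕ) : ℝ) / n) := by
          have : 0 ≤ Real.log (1 + ((1 : ℕ) : ℝ) / n) :=
            Real.log_nonneg (le_add_of_nonneg_right (by positivity))
          positivity
        rcases hmono with h | h
        · linarith
        · rw [h, Nat.cast_zero]; linarith
      have hLhi' : 2 ^ 80 * Real.log ((n : ℝ) + 1) ≤ ((Lhi + dhi.toNat : ℕ) : ℝ) := by
        rw [hlog, mul_add]
        push_cast
        have e : (dhi : ℝ) ≤ ((dhi.toNat : ℕ) : ℝ) := by
          have h1 : (dhi : ℝ) ≤ ((dhi.toNat : ℤ) : ℝ) := by exact_mod_cast Int.self_le_toNat dhi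
          have h2 : ((dhi.toNat : ℤ) : ℝ) = ((dhi.toNat : ℕ) : ℝ) := by norm_cast
          linarith
        rw [le_div_iff₀ (by positivity)] at h1hi
        linarith
      -- the test for `[n, n+1)`
      have htest' : 20 ≤ n → -(9 / 100 : ℝ) ≤ psiOneNat n - Real.log ((n : ℝ) + 1) + Real.eulerMascheroniConstant := by
        intro h20
        rcases htest with h | h
        · exfalso
          have : Nat.ble 20 n = true := Nat.ble_eq_true_of_le h20
          rw [this] at h
          exact Bool.noConfusion h
        · exact test_sound h hLhi' hP
      -- the increments at `n + 1`
      have hcast : ((n : ℝ) + 1) = ((n + 1 : ℕ) : ℝ) := by push_cast; ring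
      rw [hcast] at hLlo' hLhi'
      obtain ⟨hdP, hdQ, hrest'⟩ := consume_sound (m := n + 1) (by omega) hLlo' hvalid
      revert hcont hdP hdQ hrest'
      rcases consume (n + 1) (Llo + dlo.toNat) rest with ⟨dP, dQ, rest'⟩
      intro hcont hdP hdQ hrest'
      have hP' : ((P + dP : ℕ) : ℝ) ≤ 2 ^ 80 * psiOneNat (n + 1) := by
        rw [psiOneNat_succ, mul_add]
        push_cast at hdP ⊢
        linarith
      have hQ' : ((Q + dQ : ℕ) : ℝ) ≤ 2 ^ 80 * ∑ k ∈ Finset.Ioc 1 (n + 1), npTerm k := by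
        rw [sum_npTerm_succ, mul_add]
        push_cast
        linarith
      obtain ⟨ih1, ih2⟩ := lowerRun_sound fuel (n + 1) _ _ (P + dP) (Q + dQ) rest' hcont (by omega) (by omega)
        hrest' hLlo' hLhi' hP' hQ'
      refine ⟨fun k h1 h2 h20 ↦ ?_, by rwa [show n + (fuel + 1) = n + 1 + fuel by ring]⟩
      rcases Nat.lt_or_ge n k with hlt | hge
      · exact ih1 k (by omega) (by omega) h20
      · have hk : k = n := by omega
        subst hk
        exact htest' h20

/-- The table is valid. [folklore] -/
theorem ppList_valid : ∀ e ∈ ppList, entryOK e = true :=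
  List.all_eq_true.1 ppList_ok

/-- `ψ₁(2) = (log 2)/2` as `psiOneNat`. [folklore] -/
theorem psiOneNat_two : psiOneNat 2 = Real.log 2 / 2 := by
  unfold psiOneNat
  rw [show Finset.Icc 1 2 = {1, 2} by decide, Finset.sum_pair (by norm_num), vonMangoldt_apply_one,
    vonMangoldt_apply_prime Nat.prime_two]
  push_cast
  ring

/-- **The two kernel facts, unpacked.** [folklore] -/
theorem lower_facts :
    (∀ k : ℕ, 20 ≤ k → k ≤ 9999 →
        -(9 / 100 : ℝ) ≤ psiOneNat k - Real.log ((k : ℝ) + 1) + Real.eulerMascheroniConstant) ∧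
      (PPTHRESH : ℝ) ≤ 2 ^ 80 * ∑ k ∈ Finset.Ioc 1 10000, npTerm k := by
  have hLlo : ((ChainCheck.L2LON : ℕ) : ℝ) ≤ 2 ^ 80 * Real.log (2 : ℕ) := by
    push_cast; exact ChainCheck.L2LON_le
  have hLhi : 2 ^ 80 * Real.log (2 : ℕ) ≤ ((ChainCheck.L2HIN : ℕ) : ℝ) := by
    push_cast; exact ChainCheck.le_L2HIN
  have hP : ((ChainCheck.L2LON / 2 : ℕ) : ℝ) ≤ 2 ^ 80 * psiOneNat 2 := by
    rw [psiOneNat_two]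
    calc ((ChainCheck.L2LON / 2 : ℕ) : ℝ) ≤ (ChainCheck.L2LON : ℝ) / 2 := Nat.cast_div_le
      _ ≤ 2 ^ 80 * Real.log 2 / 2 := by gcongr; exact ChainCheck.L2LON_le
      _ = 2 ^ 80 * (Real.log 2 / 2) := by ring
  have hQ : ((0 : ℕ) : ℝ) ≤ 2 ^ 80 * ∑ k ∈ Finset.Ioc 1 2, npTerm k := by
    have : 0 ≤ ∑ k ∈ Finset.Ioc 1 2, npTerm k := Finset.sum_nonneg fun k _ ↦ npTerm_nonneg k
    simpa using this
  obtain ⟨h1, h2⟩ := lowerRun_sound 9998 2 _ _ _ 0 ppList lowerRun_holds (by omega) (by omega) ppList_valid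
    hLlo hLhi hP hQ
  exact ⟨fun k h20 hk ↦ h1 k (by omega) (by omega) h20, by simpa using h2⟩

/-- **Stub `stub_mertensLowerSmall` (registered on crux stmt-RiemannHypothesis-11229): the lower Mertens bound on the
kernel range**, in tree vocabulary: `−9/100 ≤ Σ_{n ≤ N} Λ(n)/n − log(N+1) + γ` for every natural `20 ≤ N ≤ 9999`
(hence `−9/100 ≤ E₁(y)` for real `20 ≤ y < 10⁴`). [folklore] -/
theorem stub_mertensLowerSmall : ∀ N : ℕ, 20 ≤ N → N ≤ 9999 →
    -(9 / 100 : ℝ) ≤ ∑ n ∈ Finset.Icc 1 N, (ArithmeticFunction.vonMangoldt n : ℝ) / n -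
      Real.log ((N : ℝ) + 1) + Real.eulerMascheroniConstant :=
  fun N h20 hN ↦ lower_facts.1 N h20 hN

/-- **The prime-power sum at `10⁴`**, in tree vocabulary: `0.7437 ≤ Σ_{1 < k ≤ 10⁴, k ∉ ℙ} Λ(k)/k`
(`= Σ_{pʲ ≤ 10⁴, j ≥ 2} (log p)/pʲ = 0.74377…`). [folklore] -/
theorem primePowerSum_ge :
    (0.7437 : ℝ) ≤ ∑ k ∈ Finset.Ioc (1 : ℕ) 10000,
      (if k.Prime then 0 else (ArithmeticFunction.vonMangoldt k : ℝ)) / (k : ℝ) := by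
  have h := lower_facts.2
  have h1 : (0.7437 : ℝ) * 2 ^ 80 ≤ (PPTHRESH : ℝ) := by norm_num [PPTHRESH]
  have h2 : (0.7437 : ℝ) ≤ ∑ k ∈ Finset.Ioc 1 10000, npTerm k := by nlinarith
  unfold npTerm at h2
  exact h2

end Summit.RiemannHypothesis.RiemannHypothesis.Theorems.WeilCombMertensLowerKernel
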